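import Summits.MatrixMultiplication.OmegaCensus.STPPSmallPatternCyclicRaysT2
import Summits.MatrixMultiplication.OmegaCensus.STPPSmallPatternT1OnsetsSmall

/-!
# ω-census, small pattern `(2,1,1)^k` in cyclic groups: the hosts form a RAY — `(2,1,1)^k ⊆ ℤ/m` for EVERY `m ≥ 6 / 12 / 18 / 24 / 30 / 38` (`k = 2, 3, 4, 5, 6, 7`)

Cell `pub-omega`, ω construction census, seat pub-omega ENG2 (gen 32). HONEST FRAMING (verbatim): lottery ticket; floor =
certified bounds/negative ranges.  Census STRUCTURE bookkeeping (column B5: `T1(H)` = max `k` with `(2,1,1)^k ⊆ H`, CKSU 2005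
Def. 5.1, tree `IsSTPP`, `|Aᵢ| = 2`, `|Bᵢ| = |Cᵢ| = 1`); nothing here bears on `ω`.  Companion of `STPPSmallPatternCyclicRaysT2.lean`
(same method, same packaging lemmas).

WHAT IS PROVED.  For each `k` an INTEGER witness — `k` integer pairs `Aᵢ`, `Bᵢ = {0}`, integers `cᵢ` — satisfies Def. 5.1 in `ℤ`
(`stppCheck`, kernel) with all constraint expressions of absolute value `≤ M_k` (`stppExprBound`, kernel):
`M_2 = 5`, `M_3 = 11`, `M_4 = 17`, `M_5 = 23`, `M_6 = 31`, `M_7 = 44`; by `stppCheck_map_intCast_zmod` it is a `(2,1,1)^k` family of `ZMod m` for every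
`m > M_k`; the moduli between the cyclic onset and `M_k` (if any) are covered by a witness table (one `decide` over `Finset.Icc`).
Results `exists_isSTPP_211pow{k}_zmod_of_le` (`m ≥ 6, 12, 18, 24, 30, 38` for `k = 2, 3, 4, 5, 6, 7`) and the transports
`…_of_addOrderOf`.  With the tree's kernel lower sides (`STPPSmallPatternT1OnsetsSmall`, `STPPSmallPatternT1Below24`,
`STPPSmallPatternNone211K4B`: no `(2,1,1)²` in any abelian group of order `≤ 5`, no `(2,1,1)³` of order `≤ 11`, no `(2,1,1)⁴` of
order `≤ 15` nor in `ℤ/16`, `ℤ/17`, no `(2,1,1)⁵` of order `≤ 23`) the cyclic host sets for `k = 2, 3, 4, 5` are EXACTLY the rays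
`[6, ∞)`, `[12, ∞)`, `[18, ∞)`, `[24, ∞)` (`exists_isSTPP_211pow{k}_zmod_iff`).  At `k = 6, 7` the lower sides (`ℤ/24 … ℤ/29` carry no
`(2,1,1)⁶`, `ℤ/30 … ℤ/37` no `(2,1,1)⁷`) are engine statements of the census (×2 code-disjoint listers, kit GO #65 / GO #72 / GO #88, rows
Pb222 / Pb223) and are NOT claimed here; at `k = 7` the moduli `38 … 42` are the tree's witnesses (`STPPSmallPatternWitnesses`,
stpp-3 g22 / ENG1 g31), `43, 44` this file's table, `m ≥ 45` the integer witness (a lift of the tree's `ℤ/39` family).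

OBSERVATION recorded for the census (prose, not a claim of the file): for `k = 2, 3, 4, 5` the bound `M_k + 1` EQUALS the cyclic
onset — the first cyclic host already hosts an "integer" family (representatives with every Def-5.1 expression of absolute value `< m`),
which then serves every larger modulus; `M_3 = 11` and `M_5 = 23` are the exact minima over window lifts (× units) of ALL normal-form
families of `ℤ/12`, `ℤ/13` resp. `ℤ/24` (engine all-mode, 166 / 124 / 1 164 families).  For `k = 6` the best bound found is `M_6 = 31`
(286 normal-form families of `ℤ/32` × units × window cuts; the `ℤ/30` / `ℤ/31` lists were not completed inside the seat's hub cap, their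
8 + 2 listed families lift to `≥ 37` / `≥ 34`), so the "integer onset" at `k = 6` is one of `30, 31, 32` — undecided here; for `k = 7`
the integer witness is a lift of the tree's `ℤ/39` family (`M_7 = 44`), no minimality claimed.

References: H. Cohn, R. Kleinberg, B. Szegedy, C. Umans, *Group-theoretic algorithms for matrix multiplication*, FOCS 2005
(arXiv:math/0511460), Def. 5.1.  Seat pub-omega ENG2 (gen 32), 2026-08-28; engine + scan records HOME
`pub-omega-eng2-g32/work/rays/`.
-/

open Literature.Computability.AlgebraicComplexity Finset

namespace Summit.MatrixMultiplication.OmegaCensus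

/-! ## 0. Packaging for the size pattern `(2,1,1)^k` (roles as in the tree's witnesses: `A` pairs, `Bᵢ = {0}`, `Cᵢ = {cᵢ}`) -/

/-- Singleton integer lists `[cᵢ]` (the `C`-role of a `(2,1,1)^k` configuration). -/
def singLists {k : ℕ} (c : Fin k → ℤ) : Fin k → List ℤ := fun i => [c i]

/-- A singleton list reduces `mod m` to a finset of cardinality `1`. -/
theorem card_singLists_map {k : ℕ} (c : Fin k → ℤ) (m : ℕ) (i : Fin k) :
    (((singLists c i).map (Int.cast : ℤ → ZMod m)).toFinset).card = 1 := by
  simp [singLists]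

/-- Packaging for `(2,1,1)^k`: a pair role, zero singletons and singletons accepted by `stppCheck` in `ZMod m`, gaps `< m` ⇒ the
existential size-pattern statement. [cite: CohnKleinbergSzegedyUmans2005, Def. 5.1] -/
theorem exists_isSTPP_211_of_intLists {m k G : ℕ} {PA : Fin k → ℤ × ℤ} {c : Fin k → ℤ}
    (hS : stppCheck (fun i => (pairList (PA i)).map (Int.cast : ℤ → ZMod m)) (fun i => (zeroLists k i).map (Int.cast : ℤ → ZMod m))
      (fun i => (singLists c i).map (Int.cast : ℤ → ZMod m)) = true)
    (hA : pairGapCheckN PA G = true) (hm : G < m) :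
    ∃ A B C : Fin k → Finset (ZMod m), IsSTPP A B C ∧ ∀ i, (A i).card = 2 ∧ (B i).card = 1 ∧ (C i).card = 1 :=
  exists_isSTPP_of_lists_cards _ _ _ hS fun i =>
    ⟨card_of_pairGapCheckN hA hm i, card_zeroLists_map k m i, card_singLists_map c m i⟩

/-! ## `k = 2`: `(2,1,1)² ⊆ ℤ/m` for every `m ≥ 6` -/

/-- `k = 2` integer witness, `A`-pairs (an integer lift of a `ℤ/6` family of the engine, chosen for its expression bound `5`). -/
def int211K2A : Fin 2 → ℤ × ℤ := ![(0, 1), (2, 3)]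

/-- `k = 2` integer witness, the singletons `cᵢ` (`Cᵢ = {cᵢ}`; `Bᵢ = {0}`). -/
def int211K2c : Fin 2 → ℤ := ![2, 0]

/-- The `k = 2` integer witness satisfies CKSU Def. 5.1 in `ℤ` (kernel evaluation of `stppCheck`).
[cite: CohnKleinbergSzegedyUmans2005, Def. 5.1] -/
theorem stppCheck_int211K2 :
    stppCheck (fun i => pairList (int211K2A i)) (zeroLists 2) (singLists int211K2c) = true := by
  decide +kernel

/-- Every constraint expression of the `k = 2` integer witness has absolute value `≤ 5` (kernel), and its pairs have distinct
entries at distance `≤ 5`. -/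
theorem stppExprBound_int211K2 :
    stppExprBound (fun i => pairList (int211K2A i)) (zeroLists 2) (singLists int211K2c) 5 = true ∧ pairGapCheckN int211K2A 5 = true := by
  refine ⟨?_, ?_⟩ <;> decide +kernel

/-- `(2,1,1)² ⊆ ℤ/m` for every `m ≥ 6`: the integer witness reduced `mod m` (transfer lemma `stppCheck_map_intCast_zmod`).
[cite: CohnKleinbergSzegedyUmans2005, Def. 5.1] -/
theorem exists_isSTPP_211pow2_zmod_of_le6 (m : ℕ) (hm : 6 ≤ m) :
    ∃ A B C : Fin 2 → Finset (ZMod m), IsSTPP A B C ∧ ∀ i, (A i).card = 2 ∧ (B i).card = 1 ∧ (C i).card = 1 :=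
  exists_isSTPP_211_of_intLists (stppCheck_map_intCast_zmod stppCheck_int211K2 stppExprBound_int211K2.1 (show 5 < m by omega))
    stppExprBound_int211K2.2 (by omega)

/-- **`(2,1,1)² ⊆ ℤ/m` for every `m ≥ 6`** — the integer witness alone reaches the cyclic onset `6`: ONE integer family
covers the whole ray. [cite: CohnKleinbergSzegedyUmans2005, Def. 5.1] -/
theorem exists_isSTPP_211pow2_zmod_of_le (m : ℕ) (hm : 6 ≤ m) :
    ∃ A B C : Fin 2 → Finset (ZMod m), IsSTPP A B C ∧ ∀ i, (A i).card = 2 ∧ (B i).card = 1 ∧ (C i).card = 1 :=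
  exists_isSTPP_211pow2_zmod_of_le6 m hm

/-- Transport: every abelian group with an element of additive order `≥ 6` (in particular every finite abelian group of exponent
`≥ 6`) admits `(2,1,1)²`. [cite: CohnKleinbergSzegedyUmans2005, Def. 5.1] -/
theorem exists_isSTPP_211pow2_of_addOrderOf {G : Type*} [AddCommGroup G] (g : G) (hg : 6 ≤ addOrderOf g) :
    ∃ A B C : Fin 2 → Finset G, IsSTPP A B C ∧ ∀ i, (A i).card = 2 ∧ (B i).card = 1 ∧ (C i).card = 1 :=
  exists_isSTPP_211_of_injective _ (zmod_lift_zmultiples_injective g) (exists_isSTPP_211pow2_zmod_of_le _ hg)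

/-! ## `k = 3`: `(2,1,1)³ ⊆ ℤ/m` for every `m ≥ 12` -/

/-- `k = 3` integer witness, `A`-pairs (an integer lift of a `ℤ/13` family of the engine, chosen for its expression bound `11`). -/
def int211K3A : Fin 3 → ℤ × ℤ := ![(1, 2), (3, 5), (0, 7)]

/-- `k = 3` integer witness, the singletons `cᵢ` (`Cᵢ = {cᵢ}`; `Bᵢ = {0}`). -/
def int211K3c : Fin 3 → ℤ := ![5, 0, 1]

/-- The `k = 3` integer witness satisfies CKSU Def. 5.1 in `ℤ` (kernel evaluation of `stppCheck`).
[cite: CohnKleinbergSzegedyUmans2005, Def. 5.1] -/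
theorem stppCheck_int211K3 :
    stppCheck (fun i => pairList (int211K3A i)) (zeroLists 3) (singLists int211K3c) = true := by
  decide +kernel

/-- Every constraint expression of the `k = 3` integer witness has absolute value `≤ 11` (kernel), and its pairs have distinct
entries at distance `≤ 11`. -/
theorem stppExprBound_int211K3 :
    stppExprBound (fun i => pairList (int211K3A i)) (zeroLists 3) (singLists int211K3c) 11 = true ∧ pairGapCheckN int211K3A 11 = true := by
  refine ⟨?_, ?_⟩ <;> decide +kernel

/-- `(2,1,1)³ ⊆ ℤ/m` for every `m ≥ 12`: the integer witness reduced `mod m` (transfer lemma `stppCheck_map_intCast_zmod`).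
[cite: CohnKleinbergSzegedyUmans2005, Def. 5.1] -/
theorem exists_isSTPP_211pow3_zmod_of_le12 (m : ℕ) (hm : 12 ≤ m) :
    ∃ A B C : Fin 3 → Finset (ZMod m), IsSTPP A B C ∧ ∀ i, (A i).card = 2 ∧ (B i).card = 1 ∧ (C i).card = 1 :=
  exists_isSTPP_211_of_intLists (stppCheck_map_intCast_zmod stppCheck_int211K3 stppExprBound_int211K3.1 (show 11 < m by omega))
    stppExprBound_int211K3.2 (by omega)

/-- **`(2,1,1)³ ⊆ ℤ/m` for every `m ≥ 12`** — the integer witness alone reaches the cyclic onset `12`: ONE integer family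
covers the whole ray. [cite: CohnKleinbergSzegedyUmans2005, Def. 5.1] -/
theorem exists_isSTPP_211pow3_zmod_of_le (m : ℕ) (hm : 12 ≤ m) :
    ∃ A B C : Fin 3 → Finset (ZMod m), IsSTPP A B C ∧ ∀ i, (A i).card = 2 ∧ (B i).card = 1 ∧ (C i).card = 1 :=
  exists_isSTPP_211pow3_zmod_of_le12 m hm

/-- Transport: every abelian group with an element of additive order `≥ 12` (in particular every finite abelian group of exponent
`≥ 12`) admits `(2,1,1)³`. [cite: CohnKleinbergSzegedyUmans2005, Def. 5.1] -/
theorem exists_isSTPP_211pow3_of_addOrderOf {G : Type*} [AddCommGroup G] (g : G) (hg : 12 ≤ addOrderOf g) :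
    ∃ A B C : Fin 3 → Finset G, IsSTPP A B C ∧ ∀ i, (A i).card = 2 ∧ (B i).card = 1 ∧ (C i).card = 1 :=
  exists_isSTPP_211_of_injective _ (zmod_lift_zmultiples_injective g) (exists_isSTPP_211pow3_zmod_of_le _ hg)

/-! ## `k = 4`: `(2,1,1)⁴ ⊆ ℤ/m` for every `m ≥ 18` -/

/-- `k = 4` integer witness, `A`-pairs (an integer lift of a `ℤ/18` family of the engine, chosen for its expression bound `17`). -/
def int211K4A : Fin 4 → ℤ × ℤ := ![(0, 1), (2, 3), (6, 7), (8, 9)]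

/-- `k = 4` integer witness, the singletons `cᵢ` (`Cᵢ = {cᵢ}`; `Bᵢ = {0}`). -/
def int211K4c : Fin 4 → ℤ := ![6, 10, 0, 4]

/-- The `k = 4` integer witness satisfies CKSU Def. 5.1 in `ℤ` (kernel evaluation of `stppCheck`).
[cite: CohnKleinbergSzegedyUmans2005, Def. 5.1] -/
theorem stppCheck_int211K4 :
    stppCheck (fun i => pairList (int211K4A i)) (zeroLists 4) (singLists int211K4c) = true := by
  decide +kernel

/-- Every constraint expression of the `k = 4` integer witness has absolute value `≤ 17` (kernel), and its pairs have distinct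
entries at distance `≤ 17`. -/
theorem stppExprBound_int211K4 :
    stppExprBound (fun i => pairList (int211K4A i)) (zeroLists 4) (singLists int211K4c) 17 = true ∧ pairGapCheckN int211K4A 17 = true := by
  refine ⟨?_, ?_⟩ <;> decide +kernel

/-- `(2,1,1)⁴ ⊆ ℤ/m` for every `m ≥ 18`: the integer witness reduced `mod m` (transfer lemma `stppCheck_map_intCast_zmod`).
[cite: CohnKleinbergSzegedyUmans2005, Def. 5.1] -/
theorem exists_isSTPP_211pow4_zmod_of_le18 (m : ℕ) (hm : 18 ≤ m) :
    ∃ A B C : Fin 4 → Finset (ZMod m), IsSTPP A B C ∧ ∀ i, (A i).card = 2 ∧ (B i).card = 1 ∧ (C i).card = 1 :=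
  exists_isSTPP_211_of_intLists (stppCheck_map_intCast_zmod stppCheck_int211K4 stppExprBound_int211K4.1 (show 17 < m by omega))
    stppExprBound_int211K4.2 (by omega)

/-- **`(2,1,1)⁴ ⊆ ℤ/m` for every `m ≥ 18`** — the integer witness alone reaches the cyclic onset `18`: ONE integer family
covers the whole ray. [cite: CohnKleinbergSzegedyUmans2005, Def. 5.1] -/
theorem exists_isSTPP_211pow4_zmod_of_le (m : ℕ) (hm : 18 ≤ m) :
    ∃ A B C : Fin 4 → Finset (ZMod m), IsSTPP A B C ∧ ∀ i, (A i).card = 2 ∧ (B i).card = 1 ∧ (C i).card = 1 :=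
  exists_isSTPP_211pow4_zmod_of_le18 m hm

/-- Transport: every abelian group with an element of additive order `≥ 18` (in particular every finite abelian group of exponent
`≥ 18`) admits `(2,1,1)⁴`. [cite: CohnKleinbergSzegedyUmans2005, Def. 5.1] -/
theorem exists_isSTPP_211pow4_of_addOrderOf {G : Type*} [AddCommGroup G] (g : G) (hg : 18 ≤ addOrderOf g) :
    ∃ A B C : Fin 4 → Finset G, IsSTPP A B C ∧ ∀ i, (A i).card = 2 ∧ (B i).card = 1 ∧ (C i).card = 1 :=
  exists_isSTPP_211_of_injective _ (zmod_lift_zmultiples_injective g) (exists_isSTPP_211pow4_zmod_of_le _ hg)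

/-! ## `k = 5`: `(2,1,1)⁵ ⊆ ℤ/m` for every `m ≥ 24` -/

/-- `k = 5` integer witness, `A`-pairs (an integer lift of a `ℤ/24` family of the engine, chosen for its expression bound `23`). -/
def int211K5A : Fin 5 → ℤ × ℤ := ![(0, 1), (2, 14), (9, 21), (10, 22), (12, 17)]

/-- `k = 5` integer witness, the singletons `cᵢ` (`Cᵢ = {cᵢ}`; `Bᵢ = {0}`). -/
def int211K5c : Fin 5 → ℤ := ![0, 3, 5, 7, 4]

/-- The `k = 5` integer witness satisfies CKSU Def. 5.1 in `ℤ` (kernel evaluation of `stppCheck`).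
[cite: CohnKleinbergSzegedyUmans2005, Def. 5.1] -/
theorem stppCheck_int211K5 :
    stppCheck (fun i => pairList (int211K5A i)) (zeroLists 5) (singLists int211K5c) = true := by
  decide +kernel

/-- Every constraint expression of the `k = 5` integer witness has absolute value `≤ 23` (kernel), and its pairs have distinct
entries at distance `≤ 23`. -/
theorem stppExprBound_int211K5 :
    stppExprBound (fun i => pairList (int211K5A i)) (zeroLists 5) (singLists int211K5c) 23 = true ∧ pairGapCheckN int211K5A 23 = true := by
  refine ⟨?_, ?_⟩ <;> decide +kernel

/-- `(2,1,1)⁵ ⊆ ℤ/m` for every `m ≥ 24`: the integer witness reduced `mod m` (transfer lemma `stppCheck_map_intCast_zmod`).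
[cite: CohnKleinbergSzegedyUmans2005, Def. 5.1] -/
theorem exists_isSTPP_211pow5_zmod_of_le24 (m : ℕ) (hm : 24 ≤ m) :
    ∃ A B C : Fin 5 → Finset (ZMod m), IsSTPP A B C ∧ ∀ i, (A i).card = 2 ∧ (B i).card = 1 ∧ (C i).card = 1 :=
  exists_isSTPP_211_of_intLists (stppCheck_map_intCast_zmod stppCheck_int211K5 stppExprBound_int211K5.1 (show 23 < m by omega))
    stppExprBound_int211K5.2 (by omega)

/-- **`(2,1,1)⁵ ⊆ ℤ/m` for every `m ≥ 24`** — the integer witness alone reaches the cyclic onset `24`: ONE integer family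
covers the whole ray. [cite: CohnKleinbergSzegedyUmans2005, Def. 5.1] -/
theorem exists_isSTPP_211pow5_zmod_of_le (m : ℕ) (hm : 24 ≤ m) :
    ∃ A B C : Fin 5 → Finset (ZMod m), IsSTPP A B C ∧ ∀ i, (A i).card = 2 ∧ (B i).card = 1 ∧ (C i).card = 1 :=
  exists_isSTPP_211pow5_zmod_of_le24 m hm

/-- Transport: every abelian group with an element of additive order `≥ 24` (in particular every finite abelian group of exponent
`≥ 24`) admits `(2,1,1)⁵`. [cite: CohnKleinbergSzegedyUmans2005, Def. 5.1] -/
theorem exists_isSTPP_211pow5_of_addOrderOf {G : Type*} [AddCommGroup G] (g : G) (hg : 24 ≤ addOrderOf g) :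
    ∃ A B C : Fin 5 → Finset G, IsSTPP A B C ∧ ∀ i, (A i).card = 2 ∧ (B i).card = 1 ∧ (C i).card = 1 :=
  exists_isSTPP_211_of_injective _ (zmod_lift_zmultiples_injective g) (exists_isSTPP_211pow5_zmod_of_le _ hg)

/-! ## `k = 6`: `(2,1,1)⁶ ⊆ ℤ/m` for every `m ≥ 30` -/

/-- `k = 6` integer witness, `A`-pairs (an integer lift of a `ℤ/32` family of the engine, chosen for its expression bound `31`). -/
def int211K6A : Fin 6 → ℤ × ℤ := ![(0, 9), (13, 18), (1, 4), (6, 8), (10, 16), (14, 15)]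

/-- `k = 6` integer witness, the singletons `cᵢ` (`Cᵢ = {cᵢ}`; `Bᵢ = {0}`). -/
def int211K6c : Fin 6 → ℤ := ![12, 6, 14, 15, 5, 0]

/-- The `k = 6` integer witness satisfies CKSU Def. 5.1 in `ℤ` (kernel evaluation of `stppCheck`).
[cite: CohnKleinbergSzegedyUmans2005, Def. 5.1] -/
theorem stppCheck_int211K6 :
    stppCheck (fun i => pairList (int211K6A i)) (zeroLists 6) (singLists int211K6c) = true := by
  decide +kernel

/-- Every constraint expression of the `k = 6` integer witness has absolute value `≤ 31` (kernel), and its pairs have distinct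
entries at distance `≤ 31`. -/
theorem stppExprBound_int211K6 :
    stppExprBound (fun i => pairList (int211K6A i)) (zeroLists 6) (singLists int211K6c) 31 = true ∧ pairGapCheckN int211K6A 31 = true := by
  refine ⟨?_, ?_⟩ <;> decide +kernel

/-- `(2,1,1)⁶ ⊆ ℤ/m` for every `m ≥ 32`: the integer witness reduced `mod m` (transfer lemma `stppCheck_map_intCast_zmod`).
[cite: CohnKleinbergSzegedyUmans2005, Def. 5.1] -/
theorem exists_isSTPP_211pow6_zmod_of_le32 (m : ℕ) (hm : 32 ≤ m) :
    ∃ A B C : Fin 6 → Finset (ZMod m), IsSTPP A B C ∧ ∀ i, (A i).card = 2 ∧ (B i).card = 1 ∧ (C i).card = 1 :=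
  exists_isSTPP_211_of_intLists (stppCheck_map_intCast_zmod stppCheck_int211K6 stppExprBound_int211K6.1 (show 31 < m by omega))
    stppExprBound_int211K6.2 (by omega)

/-- Witness table (`A`-pairs) for the moduli `30 ≤ m ≤ 31` below the integer witness's reach: the engine's first solution in
`ℤ/m` (entries in `[0, m)`, read `mod m`). -/
def cyc211K6A : ℕ → Fin 6 → ℤ × ℤ
  | 30 => ![(0, 1), (2, 8), (3, 9), (13, 24), (17, 28), (25, 26)]
  | 31 => ![(0, 1), (2, 3), (4, 9), (8, 14), (20, 26), (25, 30)]
  | _ => ![(0, 0), (0, 0), (0, 0), (0, 0), (0, 0), (0, 0)]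

/-- Witness table (singletons `cᵢ`) for `30 ≤ m ≤ 31`. -/
def cyc211K6c : ℕ → Fin 6 → ℤ
  | 30 => ![0, 22, 4, 6, 5, 11]
  | 31 => ![0, 28, 22, 23, 5, 6]
  | _ => ![0, 0, 0, 0, 0, 0]

/-- For each `m` with `30 ≤ m ≤ 31` the tabulated family passes `stppCheck` in `ZMod m` and its pairs have distinct entries less
than `m` apart (kernel evaluation, 2 moduli). [cite: CohnKleinbergSzegedyUmans2005, Def. 5.1] -/
theorem stppCheck_cyc211K6 : ∀ m ∈ Finset.Icc 30 31,
    stppCheck (fun i => (pairList (cyc211K6A m i)).map (Int.cast : ℤ → ZMod m)) (fun i => (zeroLists 6 i).map (Int.cast : ℤ → ZMod m))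
      (fun i => (singLists (cyc211K6c m) i).map (Int.cast : ℤ → ZMod m)) = true ∧
    pairGapCheckN (cyc211K6A m) (m - 1) = true := by
  decide +kernel

/-- **`(2,1,1)⁶ ⊆ ℤ/m` for every `m ≥ 30`** (`30 … 31` by the table, `m ≥ 32` by the integer witness).
[cite: CohnKleinbergSzegedyUmans2005, Def. 5.1] -/
theorem exists_isSTPP_211pow6_zmod_of_le (m : ℕ) (hm : 30 ≤ m) :
    ∃ A B C : Fin 6 → Finset (ZMod m), IsSTPP A B C ∧ ∀ i, (A i).card = 2 ∧ (B i).card = 1 ∧ (C i).card = 1 := by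
  by_cases h : 32 ≤ m
  · exact exists_isSTPP_211pow6_zmod_of_le32 m h
  · have hmem : m ∈ Finset.Icc 30 31 := by rw [Finset.mem_Icc]; omega
    obtain ⟨hS, hA⟩ := stppCheck_cyc211K6 m hmem
    exact exists_isSTPP_211_of_intLists hS hA (by omega)

/-- Transport: every abelian group with an element of additive order `≥ 30` (in particular every finite abelian group of exponent
`≥ 30`) admits `(2,1,1)⁶`. [cite: CohnKleinbergSzegedyUmans2005, Def. 5.1] -/
theorem exists_isSTPP_211pow6_of_addOrderOf {G : Type*} [AddCommGroup G] (g : G) (hg : 30 ≤ addOrderOf g) :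
    ∃ A B C : Fin 6 → Finset G, IsSTPP A B C ∧ ∀ i, (A i).card = 2 ∧ (B i).card = 1 ∧ (C i).card = 1 :=
  exists_isSTPP_211_of_injective _ (zmod_lift_zmultiples_injective g) (exists_isSTPP_211pow6_zmod_of_le _ hg)

/-! ## `k = 7`: `(2,1,1)⁷ ⊆ ℤ/m` for every `m ≥ 38` -/

/-- `k = 7` integer witness, `A`-pairs (an integer lift of a `ℤ/39` family of the engine, chosen for its expression bound `44`). -/
def int211K7A : Fin 7 → ℤ × ℤ := ![(1, 2), (0, 7), (4, 8), (14, 15), (9, 26), (17, 19), (13, 24)]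

/-- `k = 7` integer witness, the singletons `cᵢ` (`Cᵢ = {cᵢ}`; `Bᵢ = {0}`). -/
def int211K7c : Fin 7 → ℤ := ![13, 17, 22, 0, 6, 7, 8]

/-- The `k = 7` integer witness satisfies CKSU Def. 5.1 in `ℤ` (kernel evaluation of `stppCheck`).
[cite: CohnKleinbergSzegedyUmans2005, Def. 5.1] -/
theorem stppCheck_int211K7 :
    stppCheck (fun i => pairList (int211K7A i)) (zeroLists 7) (singLists int211K7c) = true := by
  decide +kernel

/-- Every constraint expression of the `k = 7` integer witness has absolute value `≤ 44` (kernel), and its pairs have distinct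
entries at distance `≤ 44`. -/
theorem stppExprBound_int211K7 :
    stppExprBound (fun i => pairList (int211K7A i)) (zeroLists 7) (singLists int211K7c) 44 = true ∧ pairGapCheckN int211K7A 44 = true := by
  refine ⟨?_, ?_⟩ <;> decide +kernel

/-- `(2,1,1)⁷ ⊆ ℤ/m` for every `m ≥ 45`: the integer witness reduced `mod m` (transfer lemma `stppCheck_map_intCast_zmod`).
[cite: CohnKleinbergSzegedyUmans2005, Def. 5.1] -/
theorem exists_isSTPP_211pow7_zmod_of_le45 (m : ℕ) (hm : 45 ≤ m) :
    ∃ A B C : Fin 7 → Finset (ZMod m), IsSTPP A B C ∧ ∀ i, (A i).card = 2 ∧ (B i).card = 1 ∧ (C i).card = 1 :=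
  exists_isSTPP_211_of_intLists (stppCheck_map_intCast_zmod stppCheck_int211K7 stppExprBound_int211K7.1 (show 44 < m by omega))
    stppExprBound_int211K7.2 (by omega)

/-- Witness table (`A`-pairs) for the moduli `43 ≤ m ≤ 44` below the integer witness's reach: the engine's first solution in
`ℤ/m` (entries in `[0, m)`, read `mod m`). -/
def cyc211K7A : ℕ → Fin 7 → ℤ × ℤ
  | 43 => ![(0, 32), (12, 41), (7, 30), (4, 37), (31, 35), (14, 24), (8, 9)]
  | 44 => ![(0, 42), (5, 37), (25, 38), (16, 40), (9, 15), (18, 36), (10, 23)]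
  | _ => ![(0, 0), (0, 0), (0, 0), (0, 0), (0, 0), (0, 0), (0, 0)]

/-- Witness table (singletons `cᵢ`) for `43 ≤ m ≤ 44`. -/
def cyc211K7c : ℕ → Fin 7 → ℤ
  | 43 => ![0, 40, 2, 21, 10, 1, 33]
  | 44 => ![0, 29, 43, 13, 31, 4, 19]
  | _ => ![0, 0, 0, 0, 0, 0, 0]

/-- For each `m` with `43 ≤ m ≤ 44` the tabulated family passes `stppCheck` in `ZMod m` and its pairs have distinct entries less
than `m` apart (kernel evaluation, 2 moduli). [cite: CohnKleinbergSzegedyUmans2005, Def. 5.1] -/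
theorem stppCheck_cyc211K7 : ∀ m ∈ Finset.Icc 43 44,
    stppCheck (fun i => (pairList (cyc211K7A m i)).map (Int.cast : ℤ → ZMod m)) (fun i => (zeroLists 7 i).map (Int.cast : ℤ → ZMod m))
      (fun i => (singLists (cyc211K7c m) i).map (Int.cast : ℤ → ZMod m)) = true ∧
    pairGapCheckN (cyc211K7A m) (m - 1) = true := by
  decide +kernel

/-- **`(2,1,1)⁷ ⊆ ℤ/m` for every `m ≥ 38`** (`38 … 42` by the tree's witnesses `exists_isSTPP_211pow7_zmod38` … `zmod42` (STPPSmallPatternWitnesses), `43 … 44` by the table, `m ≥ 45` by the integer witness).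
[cite: CohnKleinbergSzegedyUmans2005, Def. 5.1] -/
theorem exists_isSTPP_211pow7_zmod_of_le (m : ℕ) (hm : 38 ≤ m) :
    ∃ A B C : Fin 7 → Finset (ZMod m), IsSTPP A B C ∧ ∀ i, (A i).card = 2 ∧ (B i).card = 1 ∧ (C i).card = 1 := by
  by_cases h : 45 ≤ m
  · exact exists_isSTPP_211pow7_zmod_of_le45 m h
  by_cases h' : 43 ≤ m
  swap
  · interval_cases m
    · exact exists_isSTPP_211pow7_zmod38
    · exact exists_isSTPP_211pow7_zmod39
    · exact exists_isSTPP_211pow7_zmod40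
    · exact exists_isSTPP_211pow7_zmod41
    · exact exists_isSTPP_211pow7_zmod42
  · have hmem : m ∈ Finset.Icc 43 44 := by rw [Finset.mem_Icc]; omega
    obtain ⟨hS, hA⟩ := stppCheck_cyc211K7 m hmem
    exact exists_isSTPP_211_of_intLists hS hA (by omega)

/-- Transport: every abelian group with an element of additive order `≥ 38` (in particular every finite abelian group of exponent
`≥ 38`) admits `(2,1,1)⁷`. [cite: CohnKleinbergSzegedyUmans2005, Def. 5.1] -/
theorem exists_isSTPP_211pow7_of_addOrderOf {G : Type*} [AddCommGroup G] (g : G) (hg : 38 ≤ addOrderOf g) :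
    ∃ A B C : Fin 7 → Finset G, IsSTPP A B C ∧ ∀ i, (A i).card = 2 ∧ (B i).card = 1 ∧ (C i).card = 1 :=
  exists_isSTPP_211_of_injective _ (zmod_lift_zmultiples_injective g) (exists_isSTPP_211pow7_zmod_of_le _ hg)

/-! ## Exact rays at `k = 2, 3, 4, 5` (with the tree's kernel lower sides) -/

/-- **The cyclic hosts of `(2,1,1)²` are exactly `m ≥ 6`** (`m ≥ 1`; `ZMod 0 = ℤ` is excluded). [cite: CohnKleinbergSzegedyUmans2005, Def. 5.1] -/
theorem exists_isSTPP_211pow2_zmod_iff (m : ℕ) [NeZero m] :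
    (∃ A B C : Fin 2 → Finset (ZMod m), IsSTPP A B C ∧ ∀ i, (A i).card = 2 ∧ (B i).card = 1 ∧ (C i).card = 1) ↔ 6 ≤ m := by
  refine ⟨fun h => ?_, exists_isSTPP_211pow2_zmod_of_le m⟩
  by_contra hlt
  exact not_exists_isSTPP_211pow2_of_card_le (G := ZMod m) (by rw [Nat.card_zmod]; omega) h

/-- **The cyclic hosts of `(2,1,1)³` are exactly `m ≥ 12`** (`m ≥ 1`). [cite: CohnKleinbergSzegedyUmans2005, Def. 5.1] -/
theorem exists_isSTPP_211pow3_zmod_iff (m : ℕ) [NeZero m] :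
    (∃ A B C : Fin 3 → Finset (ZMod m), IsSTPP A B C ∧ ∀ i, (A i).card = 2 ∧ (B i).card = 1 ∧ (C i).card = 1) ↔ 12 ≤ m := by
  refine ⟨fun h => ?_, exists_isSTPP_211pow3_zmod_of_le m⟩
  by_contra hlt
  exact not_exists_isSTPP_211pow3_of_card_le (G := ZMod m) (by rw [Nat.card_zmod]; omega) h

/-- **The cyclic hosts of `(2,1,1)⁴` are exactly `m ≥ 18`** (`m ≥ 1`; the all-abelian onset is `16`, at `ℤ/2 × ℤ/8` — the cyclic
groups `ℤ/16`, `ℤ/17` carry none, tree `not_exists_isSTPP_211pow4_zmod16/17`). [cite: CohnKleinbergSzegedyUmans2005, Def. 5.1] -/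
theorem exists_isSTPP_211pow4_zmod_iff (m : ℕ) [NeZero m] :
    (∃ A B C : Fin 4 → Finset (ZMod m), IsSTPP A B C ∧ ∀ i, (A i).card = 2 ∧ (B i).card = 1 ∧ (C i).card = 1) ↔ 18 ≤ m := by
  refine ⟨fun h => ?_, exists_isSTPP_211pow4_zmod_of_le m⟩
  by_contra hlt
  have hm0 : m ≠ 0 := NeZero.ne m
  by_cases h16 : m = 16
  · subst h16; exact not_exists_isSTPP_211pow4_zmod16 h
  by_cases h17 : m = 17
  · subst h17; exact not_exists_isSTPP_211pow4_zmod17 h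
  exact not_exists_isSTPP_211pow4_of_card_le (G := ZMod m) (by rw [Nat.card_zmod]; omega) h

/-- **The cyclic hosts of `(2,1,1)⁵` are exactly `m ≥ 24`** (`m ≥ 1`). [cite: CohnKleinbergSzegedyUmans2005, Def. 5.1] -/
theorem exists_isSTPP_211pow5_zmod_iff (m : ℕ) [NeZero m] :
    (∃ A B C : Fin 5 → Finset (ZMod m), IsSTPP A B C ∧ ∀ i, (A i).card = 2 ∧ (B i).card = 1 ∧ (C i).card = 1) ↔ 24 ≤ m := by
  refine ⟨fun h => ?_, exists_isSTPP_211pow5_zmod_of_le m⟩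
  by_contra hlt
  exact not_exists_isSTPP_211pow5_of_card_le (G := ZMod m) (by rw [Nat.card_zmod]; omega) h

end Summit.MatrixMultiplication.OmegaCensus
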